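import Summits.SmoothPoincare4.SmoothPoincare4.Theses.CylinderEntropy
import Literature.Geometry.Riemannian.SphericalCylinderEntropy
import Literature.Geometry.Manifold.CylinderSlice
import Literature.Topology.FourManifolds.HomotopyS4CompactProofs
import Literature.Topology.FourManifolds.CerfGammaFourProofs
import HarnessLib

/-!
# Negative lemmas for crux `CylinderEntropy.CylinderRungTwo` (stmt-SmoothPoincare4-7631): the sandwich,
# the shape of any refutation, vacuity of the rungs below `1`, and the joint load-bearing of
# `M ≃ₕ S⁴` with the entropy bound (standing disprover, cdisprove cycle 1)

The crux R (`CylinderRungTwo`, rank 2 of route `CylinderEntropy`): a homotopy 4-sphere `M` smoothly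
embedded in `N = S⁴ × ℝ ⊂ ℝ⁶`, separating the two ends, with typed cylinder entropy `λ_cyl < 4/e`, is
diffeomorphic to `S⁴`.  Everything here is kernel-checked, in tree vocabulary
(`Literature.Geometry.Riemannian.SphericalCylinderEntropy.cylEntropy` IS the items' `⨆`,
definitionally: `cylinderRungTwo_iff_tree`), and no route item is asserted positively.

* **Sandwich / shape of a refutation.** `not_spc4_of_not_cylinderRungTwo`: the conclusion of R is
  literally the summit's for the same `M`, so `¬R → ¬SPC4`; `exotic_of_not_cylinderRungTwo` /
  `not_cylinderRungTwo_of_exotic`: `¬R` is EQUIVALENT to the existence of an exotic 4-sphere carrying a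
  thin cross-section.  Every hypothesis on `ι` only weakens R relative to SPC4, so none is load-bearing
  for truth; a disproof of R is a disproof of SPC4 with a certificate.
* **Strict threshold.** `cylinderRungTwo_iff_forall_lt`: because the entropy hypothesis is strict, R is
  exactly "the Chodosh–Mantoulidis–Schulze Cor. 1.5(b)-shape with `≤ c` for every `c < 4/e`"; the
  endpoint `≤ 4/e` is not claimed.
* **The rungs below `1` are vacuous.** `not_cylEntropy_lt_one`: for the crux's data (any homotopy
  4-sphere, any separating smooth embedding into `N`) the typed entropy is `≥ 1` (tree
  `one_le_cylEntropy_of_separatesEnds` + compactness of homotopy 4-spheres), so no threshold `c ≤ 1`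
  can be entered: the free interval of the ladder genuinely starts at the ground state.
* **Joint load-bearing.** `weakenedCrux_twoSlices_false`: dropping BOTH `M ≃ₕ S⁴` and the entropy bound
  is false (`M = S⁴ ⊔ S⁴`, `ι = twoSlices`), and the entropy bound is exactly what excludes this witness:
  `two_le_cylEntropy_twoSlices` (`λ_cyl(two slices) ≥ 2`) with `4/e < 2`
  (`not_cylEntropy_twoSlices_lt`).  So a refutation of "R without `M ≃ₕ S⁴`" needs a small-scale
  witness (slice ⊔ small far sphere, `λ_cyl → λ(S⁴) = 1.4436 < 4/e` numerically; its entropy estimate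
  is not formalisable today).
* **Transport of the slice.** `exists_thinCrossSection_of_diffeomorph`: any `M` diffeomorphic to `S⁴`
  has a cross-section of entropy `< c` as soon as `λ_cyl(slice) < c` (tree `comp_diffeomorph`); with the
  support item `SliceCalibration` this is the non-vacuity of R and the `SPC4 ⇒ E` half of "route ⇔
  SPC4" (`target_iff_spc4_of_sliceCalibration`).

Refs: Hamilton, Comm. Anal. Geom. 1 (1993) 113–126, 127–137; Ao Sun, J. Geom. Anal. 31 (2021)
(arXiv:1912.09431) Def. 1.1 / Thm. 1.5 (the functional and its monotonicity in print);
Chodosh–Mantoulidis–Schulze, Duke Math. J. (2025) Cor. 1.5(b).  Helpers only. [folklore]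
-/

noncomputable section

open MeasureTheory Set
open scoped Manifold ContDiff ENNReal Topology BigOperators ContinuousMap

set_option linter.dupNamespace false

namespace Summit.SmoothPoincare4.SmoothPoincare4.Cruxes.CylinderRungTwo.Negative

open Literature.Geometry.Manifold.CylinderSlice
open Literature.Geometry.Riemannian.SphericalCylinderEntropy
open Summit.SmoothPoincare4.SmoothPoincare4.Theses.CylinderEntropy

/-! ### The items in tree vocabulary -/

/-- `CylinderRungTwo` restated through the tree's `cylEntropy` (definitional unfolding: the items'
`⨆` IS `SphericalCylinderEntropy.cylEntropy (range ι)`). [folklore] -/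
theorem cylinderRungTwo_iff_tree :
    CylinderRungTwo ↔
      ∀ (M : Type) [TopologicalSpace M] [T2Space M] [SecondCountableTopology M]
        [ChartedSpace (EuclideanSpace ℝ (Fin 4)) M] [IsManifold (𝓡 4) ∞ M],
        M ≃ₕ Metric.sphere (0 : (EuclideanSpace ℝ (Fin 5))) 1 → ∀ ι : M → (EuclideanSpace ℝ (Fin 6)), Manifold.IsSmoothEmbedding (𝓡 4) (𝓡 6) ∞ ι →
        (∀ x, ∑ i : Fin 5, ι x (Fin.castSucc i) ^ 2 = 1) →
        (∃ R : ℝ, ∀ a b : (EuclideanSpace ℝ (Fin 6)), ∑ i : Fin 5, a (Fin.castSucc i) ^ 2 = 1 →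
          ∑ i : Fin 5, b (Fin.castSucc i) ^ 2 = 1 → a 5 ≤ -R → R ≤ b 5 →
          ¬ JoinedIn ({z : (EuclideanSpace ℝ (Fin 6)) | ∑ i : Fin 5, z (Fin.castSucc i) ^ 2 = 1} \ Set.range ι) a b) →
        cylEntropy (Set.range ι) < ENNReal.ofReal (4 / Real.exp 1) →
        Nonempty (M ≃ₘ⟮𝓡 4, 𝓡 4⟯ Metric.sphere (0 : (EuclideanSpace ℝ (Fin 5))) 1) :=
  Iff.rfl

/-- `SliceCalibration` is `λ_cyl(S⁴ × {0}) = 1` in tree vocabulary (the slice as the typed set). [folklore] -/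
theorem sliceCalibration_iff_tree :
    SliceCalibration ↔ cylEntropy {z : (EuclideanSpace ℝ (Fin 6)) | ∑ i : Fin 5, z (Fin.castSucc i) ^ 2 = 1 ∧ z 5 = 0} = 1 :=
  Iff.rfl

/-! ### Sandwich: `SPC4 → R`, and the shape of any refutation -/

/-- **`¬R → ¬SPC4`**: the conclusion of the crux is literally the summit's conclusion for the same
`M`, so a refutation of `CylinderRungTwo` is a disproof of the smooth 4-dimensional Poincaré conjecture
as typed. [folklore] -/
theorem not_spc4_of_not_cylinderRungTwo (h : ¬ CylinderRungTwo) : ¬ _root_.SmoothPoincare4 :=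
  fun hS => h fun M _ _ _ _ _ e _ _ _ _ _ => hS M ‹_› ‹_› e

/-- **The shape of ANY refutation of R**: an exotic 4-sphere carrying a cross-section of typed entropy
`< 4/e`. [folklore] -/
theorem exotic_of_not_cylinderRungTwo (h : ¬ CylinderRungTwo) :
    ∃ (M : Type) (_ : TopologicalSpace M) (_ : T2Space M) (_ : SecondCountableTopology M)
      (_ : ChartedSpace (EuclideanSpace ℝ (Fin 4)) M) (_ : IsManifold (𝓡 4) ∞ M),
      Nonempty (M ≃ₕ Metric.sphere (0 : (EuclideanSpace ℝ (Fin 5))) 1) ∧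
      (∃ ι : M → (EuclideanSpace ℝ (Fin 6)), Manifold.IsSmoothEmbedding (𝓡 4) (𝓡 6) ∞ ι ∧
        (∀ x, ∑ i : Fin 5, ι x (Fin.castSucc i) ^ 2 = 1) ∧
        (∃ R : ℝ, ∀ a b : (EuclideanSpace ℝ (Fin 6)), ∑ i : Fin 5, a (Fin.castSucc i) ^ 2 = 1 →
          ∑ i : Fin 5, b (Fin.castSucc i) ^ 2 = 1 → a 5 ≤ -R → R ≤ b 5 →
          ¬ JoinedIn ({z : (EuclideanSpace ℝ (Fin 6)) | ∑ i : Fin 5, z (Fin.castSucc i) ^ 2 = 1} \ Set.range ι) a b) ∧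
        cylEntropy (Set.range ι) < ENNReal.ofReal (4 / Real.exp 1)) ∧
      IsEmpty (M ≃ₘ⟮𝓡 4, 𝓡 4⟯ Metric.sphere (0 : (EuclideanSpace ℝ (Fin 5))) 1) := by
  by_contra h'
  apply h
  intro M _ _ _ _ _ e ι hι hN hsep hlt
  by_contra hne
  exact h' ⟨M, ‹_›, ‹_›, ‹_›, ‹_›, ‹_›, ⟨e⟩, ⟨ι, hι, hN, hsep, hlt⟩, ⟨fun d => hne ⟨d⟩⟩⟩

/-- Conversely an exotic 4-sphere with a thin cross-section refutes R, so `¬R` is EQUIVALENT to the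
existence of such a certificate. [folklore] -/
theorem not_cylinderRungTwo_of_exotic
    (h : ∃ (M : Type) (_ : TopologicalSpace M) (_ : T2Space M) (_ : SecondCountableTopology M)
      (_ : ChartedSpace (EuclideanSpace ℝ (Fin 4)) M) (_ : IsManifold (𝓡 4) ∞ M),
      Nonempty (M ≃ₕ Metric.sphere (0 : (EuclideanSpace ℝ (Fin 5))) 1) ∧
      (∃ ι : M → (EuclideanSpace ℝ (Fin 6)), Manifold.IsSmoothEmbedding (𝓡 4) (𝓡 6) ∞ ι ∧
        (∀ x, ∑ i : Fin 5, ι x (Fin.castSucc i) ^ 2 = 1) ∧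
        (∃ R : ℝ, ∀ a b : (EuclideanSpace ℝ (Fin 6)), ∑ i : Fin 5, a (Fin.castSucc i) ^ 2 = 1 →
          ∑ i : Fin 5, b (Fin.castSucc i) ^ 2 = 1 → a 5 ≤ -R → R ≤ b 5 →
          ¬ JoinedIn ({z : (EuclideanSpace ℝ (Fin 6)) | ∑ i : Fin 5, z (Fin.castSucc i) ^ 2 = 1} \ Set.range ι) a b) ∧
        cylEntropy (Set.range ι) < ENNReal.ofReal (4 / Real.exp 1)) ∧
      IsEmpty (M ≃ₘ⟮𝓡 4, 𝓡 4⟯ Metric.sphere (0 : (EuclideanSpace ℝ (Fin 5))) 1)) :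
    ¬ CylinderRungTwo := by
  obtain ⟨M, _, _, _, _, _, ⟨e⟩, ⟨ι, hι, hN, hsep, hlt⟩, hempty⟩ := h
  intro hR
  exact hempty.false (hR M e ι hι hN hsep hlt).some

/-! ### The strict threshold -/

/-- **R ↔ "CMS-shape `≤ c` for every `c < 4/e`"** (the entropy hypothesis is strict; `ℝ≥0∞` is densely
ordered).  The endpoint `≤ 4/e` of Chodosh–Mantoulidis–Schulze Cor. 1.5(b) is NOT claimed by R. [folklore] -/
theorem cylinderRungTwo_iff_forall_lt :
    CylinderRungTwo ↔ ∀ c : ℝ≥0∞, c < ENNReal.ofReal (4 / Real.exp 1) →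
      ∀ (M : Type) [TopologicalSpace M] [T2Space M] [SecondCountableTopology M]
        [ChartedSpace (EuclideanSpace ℝ (Fin 4)) M] [IsManifold (𝓡 4) ∞ M],
        M ≃ₕ Metric.sphere (0 : (EuclideanSpace ℝ (Fin 5))) 1 → ∀ ι : M → (EuclideanSpace ℝ (Fin 6)), Manifold.IsSmoothEmbedding (𝓡 4) (𝓡 6) ∞ ι →
        (∀ x, ∑ i : Fin 5, ι x (Fin.castSucc i) ^ 2 = 1) →
        (∃ R : ℝ, ∀ a b : (EuclideanSpace ℝ (Fin 6)), ∑ i : Fin 5, a (Fin.castSucc i) ^ 2 = 1 →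
          ∑ i : Fin 5, b (Fin.castSucc i) ^ 2 = 1 → a 5 ≤ -R → R ≤ b 5 →
          ¬ JoinedIn ({z : (EuclideanSpace ℝ (Fin 6)) | ∑ i : Fin 5, z (Fin.castSucc i) ^ 2 = 1} \ Set.range ι) a b) →
        cylEntropy (Set.range ι) ≤ c →
        Nonempty (M ≃ₘ⟮𝓡 4, 𝓡 4⟯ Metric.sphere (0 : (EuclideanSpace ℝ (Fin 5))) 1) := by
  refine ⟨fun h c hc M _ _ _ _ _ e ι hι hN hsep hle => h M e ι hι hN hsep (lt_of_le_of_lt hle hc),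
    fun h => ?_⟩
  intro M _ _ _ _ _ e ι hι hN hsep hlt
  obtain ⟨c, h1, h2⟩ := exists_between hlt
  exact h c h2 M e ι hι hN hsep h1.le

/-! ### The rungs below `1` are vacuous -/

/-- **Every cross-section of the crux's shape has typed entropy `≥ 1`**, so the entropy hypothesis
`< c` is UNSATISFIABLE for `c ≤ 1`: for a homotopy 4-sphere `M` (compact: tree
`compactSpace_of_homotopyEquiv_sphere_four_holds`) and a smooth embedding into `N` separating the ends,
`¬ λ_cyl(range ι) < 1` (tree `one_le_cylEntropy_of_separatesEnds`: area floor + the `τ → ∞` end of the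
supremum).  The free interval `[1, 4/e)` of the ladder cannot be entered from below. [folklore] -/
theorem not_cylEntropy_lt_one (M : Type) [TopologicalSpace M] [T2Space M] [SecondCountableTopology M]
    [ChartedSpace (EuclideanSpace ℝ (Fin 4)) M] [IsManifold (𝓡 4) ∞ M] (e : M ≃ₕ Metric.sphere (0 : (EuclideanSpace ℝ (Fin 5))) 1) (ι : M → (EuclideanSpace ℝ (Fin 6)))
    (hι : Manifold.IsSmoothEmbedding (𝓡 4) (𝓡 6) ∞ ι) (hN : ∀ x, ∑ i : Fin 5, ι x (Fin.castSucc i) ^ 2 = 1)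
    (hsep : ∃ R : ℝ, ∀ a b : (EuclideanSpace ℝ (Fin 6)), ∑ i : Fin 5, a (Fin.castSucc i) ^ 2 = 1 →
      ∑ i : Fin 5, b (Fin.castSucc i) ^ 2 = 1 → a 5 ≤ -R → R ≤ b 5 →
      ¬ JoinedIn ({z : (EuclideanSpace ℝ (Fin 6)) | ∑ i : Fin 5, z (Fin.castSucc i) ^ 2 = 1} \ Set.range ι) a b) :
    ¬ cylEntropy (Set.range ι) < 1 := by
  haveI : CompactSpace M :=
    Literature.Topology.FourManifolds.compactSpace_of_homotopyEquiv_sphere_four_holds M e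
  have hK : IsCompact (Set.range ι) := isCompact_range hι.isEmbedding.continuous
  obtain ⟨R, hR⟩ := hsep
  have hcont : Continuous fun z : (EuclideanSpace ℝ (Fin 6)) => |z 5| := (EuclideanSpace.proj (5 : Fin 6)).continuous.abs
  obtain ⟨B, hB⟩ := (hK.image hcont).isBounded.subset_closedBall 0
  have hB' : ∀ z ∈ Set.range ι, |z 5| ≤ B := fun z hz => by simpa using hB ⟨z, hz, rfl⟩
  have h1 : 1 ≤ cylEntropy (Set.range ι) :=
    one_le_cylEntropy_of_separatesEnds hK.isClosed.measurableSet (by rintro _ ⟨x, rfl⟩; exact hN x) hB' hR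
  exact not_lt_of_ge h1

/-! ### `M ≃ₕ S⁴` and the entropy bound are jointly load-bearing: two slices -/

/-- **Dropping BOTH the homotopy hypothesis and the entropy bound falsifies the crux**: `M = S⁴ ⊔ S⁴`
embedded as two slices (tree `twoSlices`: a smooth embedding into `N` whose image contains a slice,
hence separates the ends) is not diffeomorphic to `S⁴`. [folklore] -/
theorem weakenedCrux_twoSlices_false :
    ¬ (∀ (M : Type) [TopologicalSpace M] [T2Space M] [SecondCountableTopology M]
        [ChartedSpace (EuclideanSpace ℝ (Fin 4)) M] [IsManifold (𝓡 4) ∞ M],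
        ∀ ι : M → (EuclideanSpace ℝ (Fin 6)), Manifold.IsSmoothEmbedding (𝓡 4) (𝓡 6) ∞ ι →
        (∀ x, ∑ i : Fin 5, ι x (Fin.castSucc i) ^ 2 = 1) →
        (∃ R : ℝ, ∀ a b : (EuclideanSpace ℝ (Fin 6)), ∑ i : Fin 5, a (Fin.castSucc i) ^ 2 = 1 →
          ∑ i : Fin 5, b (Fin.castSucc i) ^ 2 = 1 → a 5 ≤ -R → R ≤ b 5 →
          ¬ JoinedIn ({z : (EuclideanSpace ℝ (Fin 6)) | ∑ i : Fin 5, z (Fin.castSucc i) ^ 2 = 1} \ Set.range ι) a b) →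
        Nonempty (M ≃ₘ⟮𝓡 4, 𝓡 4⟯ Metric.sphere (0 : (EuclideanSpace ℝ (Fin 5))) 1)) := by
  intro h
  have hsub : {z : (EuclideanSpace ℝ (Fin 6)) | ∑ i : Fin 5, z (Fin.castSucc i) ^ 2 = 1 ∧ z 5 = 0} ⊆ Set.range twoSlices := by
    rw [range_twoSlices]; exact Set.subset_union_left
  obtain ⟨d⟩ := h (Metric.sphere (0 : (EuclideanSpace ℝ (Fin 5))) 1 ⊕ Metric.sphere (0 : (EuclideanSpace ℝ (Fin 5))) 1) twoSlices
    isSmoothEmbedding_twoSlices sum_sq_twoSlices (separatesEnds_of_slice_subset hsub)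
  exact isEmpty_diffeomorph_twoSpheres.false d

/-- **Why two slices do NOT refute R at `4/e`**: the two-slice configuration has typed entropy `≥ 2`
(entropy ≥ normalised area, tree `measure_ratio_le_cylEntropy`, and each slice has the measure of `S⁴`,
tree `hausdorffMeasure_range_sliceMap`). [folklore] -/
theorem two_le_cylEntropy_twoSlices : 2 ≤ cylEntropy (Set.range twoSlices) := by
  have hrange : Set.range twoSlices = Set.range (sliceMap 0) ∪ Set.range (sliceMap 1) := by
    rw [twoSlices, Set.Sum.elim_range]
  have hdisj : Disjoint (Set.range (sliceMap 0)) (Set.range (sliceMap 1)) := by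
    rw [Set.disjoint_iff]
    rintro z ⟨⟨x, rfl⟩, ⟨y, hy⟩⟩
    have h := congrArg (fun z : (EuclideanSpace ℝ (Fin 6)) => z 5) hy
    simp only [sliceMap_apply_last] at h
    exact one_ne_zero h
  have hμ : μH[4] (Set.range twoSlices) = 2 * μH[4] (Metric.sphere (0 : (EuclideanSpace ℝ (Fin 5))) 1) := by
    rw [hrange, measure_union hdisj (measurableSet_range_sliceMap 1), hausdorffMeasure_range_sliceMap,
      hausdorffMeasure_range_sliceMap, two_mul]
  have hAm : MeasurableSet (Set.range twoSlices) := by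
    rw [hrange]; exact (measurableSet_range_sliceMap 0).union (measurableSet_range_sliceMap 1)
  have hAN : ∀ z ∈ Set.range twoSlices, ∑ i : Fin 5, z (Fin.castSucc i) ^ 2 = 1 := by
    rintro _ ⟨x, rfl⟩; exact sum_sq_twoSlices x
  have hB : ∀ z ∈ Set.range twoSlices, |z 5| ≤ 1 := by
    rintro _ ⟨x, rfl⟩
    rcases x with x | x <;> simp [twoSlices, sliceMap_apply_last]
  have hle := measure_ratio_le_cylEntropy hAm hAN hB
  rw [hμ, ← mul_assoc, mul_comm ((μH[4] (Metric.sphere (0 : (EuclideanSpace ℝ (Fin 5))) 1))⁻¹) 2, mul_assoc,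
    ENNReal.inv_mul_cancel hausdorffMeasure_sphere_four_pos.ne' hausdorffMeasure_sphere_four_lt_top.ne,
    mul_one] at hle
  exact hle

/-- `4/e < 2`. [folklore] -/
theorem four_div_exp_one_lt_two : 4 / Real.exp 1 < 2 := by
  rw [div_lt_iff₀ (Real.exp_pos 1)]
  linarith [Real.exp_one_gt_d9]

/-- **The entropy hypothesis of R is what excludes the two-slice witness** (`λ_cyl ≥ 2 > 4/e`): a
refutation of "R without `M ≃ₕ S⁴`" must use a small-scale witness (slice ⊔ small far sphere, or the
slice with one thin `S³` handle). [folklore] -/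
theorem not_cylEntropy_twoSlices_lt :
    ¬ cylEntropy (Set.range twoSlices) < ENNReal.ofReal (4 / Real.exp 1) := by
  intro hlt
  have h : (2 : ℝ≥0∞) < ENNReal.ofReal (4 / Real.exp 1) := lt_of_le_of_lt two_le_cylEntropy_twoSlices hlt
  rw [show (2 : ℝ≥0∞) = ENNReal.ofReal 2 by simp, ENNReal.ofReal_lt_ofReal_iff (by positivity)] at h
  linarith [four_div_exp_one_lt_two]

/-! ### Transport of the slice along a diffeomorphism -/

/-- **Any `M` diffeomorphic to `S⁴` has a cross-section of typed entropy `< c` as soon as the slice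
does** (`ι = sliceMap 0 ∘ d`: a smooth embedding by the tree's `IsSmoothEmbedding.comp_diffeomorph`, in
`N`, with image the slice, which separates the ends).  With the support item `SliceCalibration`
(`λ_cyl(slice) = 1 < 4/e`) this is the non-vacuity of R (take `M = S⁴`) and the half `SPC4 ⇒ E` of the
route's "`E ∧ R ⇔ SPC4`". [folklore] -/
theorem exists_thinCrossSection_of_diffeomorph {c : ℝ≥0∞}
    (hcal : cylEntropy {z : (EuclideanSpace ℝ (Fin 6)) | ∑ i : Fin 5, z (Fin.castSucc i) ^ 2 = 1 ∧ z 5 = 0} < c)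
    (M : Type) [TopologicalSpace M] [ChartedSpace (EuclideanSpace ℝ (Fin 4)) M] [IsManifold (𝓡 4) ∞ M]
    (d : M ≃ₘ⟮𝓡 4, 𝓡 4⟯ Metric.sphere (0 : (EuclideanSpace ℝ (Fin 5))) 1) :
    ∃ ι : M → (EuclideanSpace ℝ (Fin 6)), Manifold.IsSmoothEmbedding (𝓡 4) (𝓡 6) ∞ ι ∧
      (∀ x, ∑ i : Fin 5, ι x (Fin.castSucc i) ^ 2 = 1) ∧
      (∃ R : ℝ, ∀ a b : (EuclideanSpace ℝ (Fin 6)), ∑ i : Fin 5, a (Fin.castSucc i) ^ 2 = 1 →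
        ∑ i : Fin 5, b (Fin.castSucc i) ^ 2 = 1 → a 5 ≤ -R → R ≤ b 5 →
        ¬ JoinedIn ({z : (EuclideanSpace ℝ (Fin 6)) | ∑ i : Fin 5, z (Fin.castSucc i) ^ 2 = 1} \ Set.range ι) a b) ∧
      cylEntropy (Set.range ι) < c := by
  have hr : Set.range (sliceMap 0 ∘ d) = {z : (EuclideanSpace ℝ (Fin 6)) | ∑ i : Fin 5, z (Fin.castSucc i) ^ 2 = 1 ∧ z 5 = 0} := by
    rw [Set.range_comp, EquivLike.range_eq_univ d, Set.image_univ, range_sliceMap]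
  refine ⟨sliceMap 0 ∘ d, (isSmoothEmbedding_sliceMap 0).comp_diffeomorph d,
    fun x => sum_sq_sliceMap 0 (d x), ?_, ?_⟩
  · rw [hr]; exact separatesEnds_of_slice_subset (c := 0) subset_rfl
  · rw [hr]; exact hcal

/-- **"`E ∧ R ⇔ SPC4`" modulo calibration**: given the support item `SliceCalibration`, the route's
target `Target = ThinCrossSectionExists ∧ CylinderRungTwo` is EQUIVALENT to the summit — the line is
exactly as hard as SPC4, no easier (`closes`) and no harder (SPC4 gives R by the sandwich and E by
transporting the slice). [folklore] -/
theorem target_iff_spc4_of_sliceCalibration (hcal : SliceCalibration) :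
    Target ↔ _root_.SmoothPoincare4 := by
  -- `Target` is now the INLINED conjunction `E ∧ R` (route rev ≥ the 2026-08-17 restatement) and the
  -- route's `closes` no longer takes `(R, E)`; `Target → SPC4` is pure logic (E feeds R), and
  -- `SPC4 → Target` is the sandwich + the transported slice, as before.
  refine ⟨fun h => ?_, fun hS => ⟨?_, fun M _ _ _ _ _ e _ _ _ _ _ => hS M ‹_› ‹_› e⟩⟩
  · unfold _root_.SmoothPoincare4 Literature.SPC4.SmoothPoincareConjectureFour
      ContinuousMap.HomotopyEquiv.NonemptyDiffeomorphSphere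
    intro M _ _ _ _ _ e
    obtain ⟨ι, hι, hs, hR, hent⟩ := h.1 M e
    exact h.2 M e ι hι hs hR hent
  · intro M _ _ _ _ _ e
    obtain ⟨d⟩ := hS M ‹_› ‹_› e
    have hc : cylEntropy {z : (EuclideanSpace ℝ (Fin 6)) | ∑ i : Fin 5, z (Fin.castSucc i) ^ 2 = 1 ∧ z 5 = 0} <
        ENNReal.ofReal (4 / Real.exp 1) := by
      rw [sliceCalibration_iff_tree.mp hcal, ENNReal.one_lt_ofReal, lt_div_iff₀ (Real.exp_pos 1)]
      linarith [Real.exp_one_lt_d9]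
    obtain ⟨ι, h1, h2, h3, h4⟩ := exists_thinCrossSection_of_diffeomorph hc M d
    exact ⟨ι, h1, h2, h3, h4⟩

end Summit.SmoothPoincare4.SmoothPoincare4.Cruxes.CylinderRungTwo.Negative
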